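import Mathlib.FieldTheory.Minpoly.IsIntegrallyClosed
import Mathlib.FieldTheory.Minpoly.Field
import Mathlib.FieldTheory.Minpoly.Finite
import Mathlib.RingTheory.Ideal.Quotient.Operations
import Mathlib.RingTheory.Ideal.Maximal
import Mathlib.Algebra.Polynomial.Roots
import HarnessLib

/-!
# Ring 2 / AbelianAll — the fibre of a finite morphism onto a normal variety has at most `deg` points (WEIL-2 gen 65, CERT-G65)

research route, not a corollary; conditional on HC_CM plus one named minimal statement.
`HC_CM` occurs nowhere in this file; nothing here is a case of the Hodge conjecture.

Fact-free commutative-algebra core of the COMPLETENESS step of the account `CERT-G65.md` (pub-hodge-ring2,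
seat ab-weil-2, gen 65): Shafarevich, *Basic Algebraic Geometry 1*, Chap. II §6.3, Theorem 2.28 — if
`f : X → Y` is a finite map of irreducible varieties and `Y` is NORMAL, then every point of `Y` has at most
`deg f` inverse images.  Applied to the finite part `X′ → Â` of the Stein factorisation of Schoen's map
`F : Y⁽⁸⁾ → Â` (`deg F = 54`), it turns «54 distinct étale points in the fibre `F⁻¹(F(E₀))`» (certified in ball
arithmetic) into «the fibre IS these 54 reduced points», with no genericity hypothesis.

The algebra (Shafarevich's proof): let `A → B` be an integral ring extension, `𝔪 ⊂ A` maximal, and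
`M₁, …, M_r` distinct maximal ideals of `B` over `𝔪` (the points of the fibre).  If every `b ∈ B` has a minimal
polynomial over `A` of degree `≤ n`, and `A/𝔪` has `r` distinct elements `c̄₁, …, c̄_r` (automatic for `r`
points when `A/𝔪` is infinite, e.g. `ℂ`), then `r ≤ n`: choose `b ≡ cᵢ (mod Mᵢ)` by the Chinese remainder
theorem; the minimal polynomial `F ∈ A[X]` of `b` is monic of degree `≤ n`, `F(cᵢ) ∈ Mᵢ ∩ A = 𝔪`, so `F mod 𝔪`
vanishes at the `r` distinct `c̄ᵢ`.  (No hypothesis on the residue fields of the `Mᵢ` is needed.)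
(`theorem card_le_of_minpoly_natDegree_le`.)  For an integrally closed domain `A` with fraction field `K` and a
domain `B ⊇ A` with fraction field `L`, `[L : K] = n`, the degree hypothesis holds
(`theorem minpoly_natDegree_le_finrank`, Mathlib's `minpoly.isIntegrallyClosed_eq_field_fractions'`), which
gives the theorem in the form used (`theorem card_le_finrank`): at most `[L : K]` rational points in a fibre.
Over `ℂ` every closed point is rational and `ℂ` is infinite, so this is Theorem 2.28 verbatim for affine
pieces; the geometric statement follows by covering `Y` with affine opens.
-/

namespace Summit.HodgeConjecture.Ring2AbelianAll.FibreCardinality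

open Polynomial

/-- SHAFAREVICH II.6.3 THEOREM 2.28, algebraic core.  `A → B` integral, every element of `B` of degree `≤ n`
over `A`; `𝔪` a maximal ideal of `A`; `M : ι → Ideal B` an injective family of maximal ideals of `B` lying over
`𝔪`; `c : ι → A` pairwise distinct modulo `𝔪` (a supply of `card ι` distinct residues).  Then `card ι ≤ n`. -/
theorem card_le_of_minpoly_natDegree_le
    {A B : Type*} [CommRing A] [CommRing B] [Algebra A B] [Algebra.IsIntegral A B]
    (n : ℕ) (hn : ∀ b : B, (minpoly A b).natDegree ≤ n)
    (𝔪 : Ideal A) [h𝔪 : 𝔪.IsMaximal]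
    {ι : Type*} [Fintype ι] (M : ι → Ideal B) (hmax : ∀ i, (M i).IsMaximal) (hinj : Function.Injective M)
    (hover : ∀ i, 𝔪 ≤ (M i).comap (algebraMap A B))
    (c : ι → A) (hc : ∀ i j, i ≠ j → c i - c j ∉ 𝔪) :
    Fintype.card ι ≤ n := by
  classical
  -- Chinese remainder: b ∈ B with b ≡ c i (mod M i) for every i
  have hcop : Pairwise fun i j => IsCoprime (M i) (M j) := by
    intro i j hij
    rw [Ideal.isCoprime_iff_sup_eq]
    exact (hmax i).coprime_of_ne (hmax j) (fun h => hij (hinj h))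
  obtain ⟨q, hq⟩ := Ideal.quotientInfToPiQuotient_surj hcop
    (fun i => Ideal.Quotient.mk (M i) (algebraMap A B (c i)))
  obtain ⟨b, rfl⟩ := Ideal.Quotient.mk_surjective q
  have hb : ∀ i, Ideal.Quotient.mk (M i) b = Ideal.Quotient.mk (M i) (algebraMap A B (c i)) := by
    intro i
    have := congrFun hq i
    rwa [Ideal.quotientInfToPiQuotient_mk'] at this
  -- the minimal polynomial of b and its reduction mod 𝔪
  set F : A[X] := minpoly A b with hF
  have hint : IsIntegral A b := Algebra.IsIntegral.isIntegral b
  have hFm : F.Monic := minpoly.monic hint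
  let k := A ⧸ 𝔪
  set Fbar : k[X] := F.map (Ideal.Quotient.mk 𝔪) with hFbar
  have hFbarm : Fbar.Monic := hFm.map _
  have hFbar0 : Fbar ≠ 0 := hFbarm.ne_zero
  have hdeg : Fbar.natDegree ≤ n := by
    rw [hFbar, hFm.natDegree_map]; exact hn b
  -- each c̄ i is a root of Fbar
  have hroot : ∀ i, Fbar.IsRoot (Ideal.Quotient.mk 𝔪 (c i)) := by
    intro i
    -- evaluate F at b, push to B/M i
    have h1 : aeval (Ideal.Quotient.mk (M i) b) F = 0 := by
      have : aeval b F = 0 := minpoly.aeval A b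
      have h := congrArg (Ideal.Quotient.mkₐ A (M i)) this
      rwa [map_zero, ← Polynomial.aeval_algHom_apply] at h
    rw [hb i, Ideal.Quotient.mk_algebraMap, Polynomial.aeval_algebraMap_apply_eq_algebraMap_eval] at h1
    -- so eval (c i) F ∈ ker (A → B/M i) = comap of M i = 𝔪 (a proper ideal containing the maximal 𝔪)
    have hker : F.eval (c i) ∈ (M i).comap (algebraMap A B) := by
      rw [Ideal.mem_comap, ← Ideal.Quotient.eq_zero_iff_mem, Ideal.Quotient.mk_algebraMap]
      exact h1
    have hcomap : (M i).comap (algebraMap A B) = 𝔪 := by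
      refine (h𝔪.eq_of_le ?_ (hover i)).symm
      exact Ideal.comap_ne_top _ (hmax i).ne_top
    rw [hcomap] at hker
    rw [Polynomial.IsRoot, hFbar, Polynomial.eval_map, Polynomial.eval₂_hom, Ideal.Quotient.eq_zero_iff_mem]
    exact hker
  -- distinct roots
  have hinjc : Function.Injective fun i => Ideal.Quotient.mk 𝔪 (c i) := by
    intro i j hij
    by_contra hne
    exact hc i j hne (Ideal.Quotient.eq.mp hij)
  calc Fintype.card ι = (Finset.univ.image fun i => Ideal.Quotient.mk 𝔪 (c i)).card := by
        rw [Finset.card_image_of_injective _ hinjc, Finset.card_univ]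
    _ ≤ Fbar.roots.toFinset.card := by
        apply Finset.card_le_card
        intro x hx
        obtain ⟨i, -, rfl⟩ := Finset.mem_image.mp hx
        rw [Multiset.mem_toFinset, Polynomial.mem_roots hFbar0]
        exact hroot i
    _ ≤ Multiset.card Fbar.roots := Multiset.toFinset_card_le _
    _ ≤ Fbar.natDegree := Polynomial.card_roots' _
    _ ≤ n := hdeg

/-- Degree hypothesis from the generic degree: `A` an integrally closed domain with fraction field `K`, `B ⊇ A` a
domain, integral over `A`, with fraction field `L ⊇ K`, `[L : K] < ∞`.  Then every `b ∈ B` has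
`natDegree (minpoly A b) ≤ [L : K]` (the minimal polynomial over `A` IS the one over `K`, Gauss's lemma in the
form `minpoly.isIntegrallyClosed_eq_field_fractions'`). -/
theorem minpoly_natDegree_le_finrank
    {A B K L : Type*} [CommRing A] [IsDomain A] [IsIntegrallyClosed A] [CommRing B] [IsDomain B]
    [Algebra A B] [Algebra.IsIntegral A B]
    [Field K] [Field L] [Algebra A K] [IsFractionRing A K] [Algebra B L] [Algebra A L] [Algebra K L]
    [IsScalarTower A B L] [IsScalarTower A K L] [FiniteDimensional K L]
    (hBL : Function.Injective (algebraMap B L)) (b : B) :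
    (minpoly A b).natDegree ≤ Module.finrank K L := by
  have hint : IsIntegral A b := Algebra.IsIntegral.isIntegral b
  have hintL : IsIntegral A (algebraMap B L b) := hint.map (IsScalarTower.toAlgHom A B L)
  have h1 : minpoly A (algebraMap B L b) = minpoly A b := minpoly.algebraMap_eq hBL b
  have h2 : minpoly K (algebraMap B L b) = (minpoly A (algebraMap B L b)).map (algebraMap A K) :=
    minpoly.isIntegrallyClosed_eq_field_fractions' K hintL
  have h3 : (minpoly K (algebraMap B L b)).natDegree ≤ Module.finrank K L := minpoly.natDegree_le _
  rw [h2, (minpoly.monic hintL).natDegree_map, h1] at h3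
  exact h3

/-- SHAFAREVICH, Basic Algebraic Geometry 1, II.6.3, THEOREM 2.28 (ring-theoretic form).  `A ⊆ B` an integral
extension of domains, `A` integrally closed («`Y` normal»), fraction fields `K ⊆ L` with `[L : K] = deg f`;
`𝔪` a maximal ideal of `A` (a point `y ∈ Y`); `M : ι → Ideal B` distinct maximal ideals over `𝔪` (points of
`f⁻¹(y)`); if `A/𝔪` contains `card ι` pairwise distinct classes `c i` (automatic when `A/𝔪` is infinite,
e.g. `= ℂ`), then `card ι ≤ [L : K]`:
**a point of a normal variety has at most `deg f` inverse images under a finite map.** -/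
theorem card_le_finrank
    {A B K L : Type*} [CommRing A] [IsDomain A] [IsIntegrallyClosed A] [CommRing B] [IsDomain B]
    [Algebra A B] [Algebra.IsIntegral A B]
    [Field K] [Field L] [Algebra A K] [IsFractionRing A K] [Algebra B L] [Algebra A L] [Algebra K L]
    [IsScalarTower A B L] [IsScalarTower A K L] [FiniteDimensional K L]
    (hBL : Function.Injective (algebraMap B L))
    (𝔪 : Ideal A) [𝔪.IsMaximal]
    {ι : Type*} [Fintype ι] (M : ι → Ideal B) (hmax : ∀ i, (M i).IsMaximal) (hinj : Function.Injective M)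
    (hover : ∀ i, 𝔪 ≤ (M i).comap (algebraMap A B))
    (c : ι → A) (hc : ∀ i j, i ≠ j → c i - c j ∉ 𝔪) :
    Fintype.card ι ≤ Module.finrank K L :=
  card_le_of_minpoly_natDegree_le (Module.finrank K L) (minpoly_natDegree_le_finrank hBL) 𝔪 M hmax hinj
    hover c hc

end Summit.HodgeConjecture.Ring2AbelianAll.FibreCardinality
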